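import Summits.NavierStokesRegularity.NavierStokesRegularity.Theorems.EulerZoomLiouvillePowerGaugeEulerLiouvilleNeedleSlices
import HarnessLib

/-!
# Crux E `PowerGaugeEulerLiouville` (stmt-NavierStokesRegularity-19832) — SUB-`(2+ρ)` GRADIENT GROWTH IS TAME, file 1/2: TOOLS

Route №10 `EulerZoomLiouville` (NavierStokesRegularity), crux E, THE ONE STATEMENT `stub_selfSimilarC2Needle` (skeleton of
record `Cruxes/PowerGaugeEulerLiouville/Lines/birth.lean`, interim LEAD ns-typeII-p2 g10; second lane of ns-ezl-w1 g2, LEAD GO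
2026-08-28T09:39:05Z).  File 2/2 `…NeedleGradientGrowth.lean` proves: a `C¹` profile with the class A-growth and op-norm E-weight
and POLYNOMIAL GRADIENT GROWTH `‖∇V(y)‖ ≤ K(1+‖y‖)^q`, `q < 2+ρ`, has NO fast radial inflow far out (hence, for members, is
trivial) — by nsreg-p2 g31's needle-thinness kernel `NeedleThinness.needle_inradius_le_radial` on a SHORT coaxial cylinder around a
fast point.  THIS FILE holds the kernel-free bookkeeping:

* `exists_orthonormal_frame` — every unit vector of `ℝ³` heads an orthonormal frame `![e, e₁, e₂]`;
* `discChart_mem_ball_of_short` — the coaxial cylinder `{t e + discChart z : |t − s| < r/4, ‖z‖ ≤ r/2}` lies in `B(s e, r)`;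
* `inflow_on_ball` — mean-value step: `⟪e,V y⟫ < −κ s`, `‖∇V‖ ≤ G` on `B(y,r)`, `G r ≤ κ s/2` ⇒ `−⟪e,V⟫ ≥ κ s/2` on `B(y,r)`;
* `tendsto_rpow_mul_exp_neg_rpow` — `s^{a} e^{−b s^θ} → 0` (`θ, b > 0`);
* `aux_envelope_le`, `aux_grad_ball`, `aux_budget_le`, `aux_fit`, `aux_exponent_ge`, `aux_contra` — the real-variable
  inequalities of the instantiation (each its own declaration, so each elaborates within the default heartbeat budget).

WHAT THIS IS NOT: not NS, not E — tools; 19832 OPEN.  [folklore]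
-/

noncomputable section

set_option linter.dupNamespace false

open MeasureTheory Set Filter Topology Metric Function Real
open scoped RealInnerProductSpace ENNReal NNReal

namespace Summit.NavierStokesRegularity.NavierStokesRegularity.Theorems.PowerGaugeEulerLiouville.NeedleGradientGrowth

open NeedleDiscChart NeedleThinness

/-! ## Frames and the gradient budget on balls -/

/-- Every unit vector `e` of `ℝ³` is the first vector of an orthonormal frame `![e, e₁, e₂]` (an orthonormal basis of
`(ℝ e)ᗮ`, which has dimension `2`). [folklore] -/
theorem exists_orthonormal_frame {e : EuclideanSpace ℝ (Fin 3)} (he : ‖e‖ = 1) :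
    ∃ e₁ e₂ : EuclideanSpace ℝ (Fin 3), Orthonormal ℝ ![e, e₁, e₂] := by
  have he0 : e ≠ 0 := by rw [← norm_ne_zero_iff, he]; exact one_ne_zero
  haveI : Fact (Module.finrank ℝ (EuclideanSpace ℝ (Fin 3)) = 2 + 1) := ⟨by simp⟩
  have hdim : Module.finrank ℝ (ℝ ∙ e)ᗮ = 2 := Submodule.finrank_orthogonal_span_singleton he0
  let b : OrthonormalBasis (Fin 2) ℝ (ℝ ∙ e)ᗮ := (stdOrthonormalBasis ℝ (ℝ ∙ e)ᗮ).reindex (finCongr hdim)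
  have hn : ∀ i, ‖(b i : EuclideanSpace ℝ (Fin 3))‖ = 1 := fun i => by
    have h := b.orthonormal.1 i
    rwa [Submodule.coe_norm] at h
  have h01 : ⟪(b 0 : EuclideanSpace ℝ (Fin 3)), (b 1 : EuclideanSpace ℝ (Fin 3))⟫ = 0 := by
    have h : ⟪b 0, b 1⟫ = 0 := b.orthonormal.2 (show (0 : Fin 2) ≠ 1 by decide)
    rwa [Submodule.coe_inner] at h
  have hei : ∀ i, ⟪e, (b i : EuclideanSpace ℝ (Fin 3))⟫ = 0 := fun i =>
    (Submodule.mem_orthogonal_singleton_iff_inner_right).1 (b i).2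
  exact ⟨(b 0 : EuclideanSpace ℝ (Fin 3)), (b 1 : EuclideanSpace ℝ (Fin 3)),
    orthonormal_frame he (hn 0) (hn 1) (hei 0) (hei 1) h01⟩

/-! ## The short cylinder around a fast point -/

/-- The coaxial cylinder `{t e + discChart z : t ∈ (s − r/4, s + r/4), ‖z‖ ≤ r/2}` lies in the ball `B(s e, r)`. [folklore] -/
theorem discChart_mem_ball_of_short {e e₁ e₂ : EuclideanSpace ℝ (Fin 3)} (hon : Orthonormal ℝ ![e, e₁, e₂])
    {s r t : ℝ} (hr : 0 < r) (ht : t ∈ Ioo (s - r / 4) (s - r / 4 + r / 2)) {z : ℂ} (hz : ‖z‖ ≤ r / 2) :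
    discChart (t • e) e₁ e₂ z ∈ ball (s • e) r := by
  rw [mem_ball, dist_eq_norm]
  have hdiff : discChart (t • e) e₁ e₂ z - s • e = discChart ((t - s) • e) e₁ e₂ z := by
    simp only [discChart, sub_smul]
    abel
  have hc1 : ⟪(t - s) • e, e₁⟫ = 0 := by rw [real_inner_smul_left, inner_frame₀₁ hon, mul_zero]
  have hc2 : ⟪(t - s) • e, e₂⟫ = 0 := by rw [real_inner_smul_left, inner_frame₀₂ hon, mul_zero]
  have hsq : ‖discChart ((t - s) • e) e₁ e₂ z‖ ^ 2 = (t - s) ^ 2 + ‖z‖ ^ 2 := by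
    rw [norm_discChart_sq (norm_frame₁ hon) (norm_frame₂ hon) (inner_frame₁₂ hon) hc1 hc2, norm_smul,
      norm_frame₀ hon, mul_one, Real.norm_eq_abs, sq_abs]
  rw [hdiff]
  have h1 : s - r / 4 < t := ht.1
  have h2 : t < s + r / 4 := by linarith [ht.2]
  have hlt : ‖discChart ((t - s) • e) e₁ e₂ z‖ ^ 2 < r ^ 2 := by
    rw [hsq]
    have hz2 : ‖z‖ ^ 2 ≤ (r / 2) ^ 2 := pow_le_pow_left₀ (norm_nonneg z) hz 2
    nlinarith
  exact lt_of_pow_lt_pow_left₀ 2 hr.le hlt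

/-- **Mean-value step.**  If `⟪e, V y⟫ < −κ s` at `y`, `‖e‖ = 1`, and `‖∇V‖ ≤ G` on the ball `B(y, r)` with
`G r ≤ κ s/2`, then `−⟪e, V⟫ ≥ κ s/2` on `B(y, r)`. [folklore] -/
theorem inflow_on_ball {V : EuclideanSpace ℝ (Fin 3) → EuclideanSpace ℝ (Fin 3)} (hVd : Differentiable ℝ V)
    {e y : EuclideanSpace ℝ (Fin 3)} {s κ G r : ℝ} (he : ‖e‖ = 1) (hfast : ⟪e, V y⟫ < -(κ * s))
    (hG : ∀ y' ∈ ball y r, ‖fderiv ℝ V y'‖ ≤ G) (hGr : G * r ≤ κ * s / 2) (hr : 0 < r)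
    {y' : EuclideanSpace ℝ (Fin 3)} (hy' : y' ∈ ball y r) : κ * s / 2 ≤ -⟪e, V y'⟫ := by
  have hmvt : ‖V y' - V y‖ ≤ G * ‖y' - y‖ :=
    (convex_ball y r).norm_image_sub_le_of_norm_fderiv_le (fun x _ => hVd.differentiableAt) hG
      (mem_ball_self hr) hy'
  have hdist : ‖y' - y‖ < r := by rwa [mem_ball, dist_eq_norm] at hy'
  have hG0 : 0 ≤ G := (norm_nonneg _).trans (hG y (mem_ball_self hr))
  have hinner : ⟪e, V y'⟫ - ⟪e, V y⟫ ≤ ‖V y' - V y‖ := by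
    rw [← inner_sub_right]
    exact (real_inner_le_norm _ _).trans (by rw [he, one_mul])
  have : G * ‖y' - y‖ ≤ G * r := mul_le_mul_of_nonneg_left hdist.le hG0
  linarith

/-! ## Exponential beats power -/

/-- `s^{a} · exp(−b s^θ) → 0` as `s → ∞` for `θ > 0`, `b > 0`. [folklore] -/
theorem tendsto_rpow_mul_exp_neg_rpow {a b θ : ℝ} (hb : 0 < b) (hθ : 0 < θ) :
    Tendsto (fun s : ℝ => s ^ a * Real.exp (-(b * s ^ θ))) atTop (𝓝 0) := by
  have h := (tendsto_rpow_mul_exp_neg_mul_atTop_nhds_zero (a / θ) b hb).comp (tendsto_rpow_atTop hθ)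
  refine h.congr' ?_
  filter_upwards [eventually_gt_atTop 0] with s hs
  have hθa : θ * (a / θ) = a := by field_simp
  simp only [Function.comp_apply]
  rw [← Real.rpow_mul hs.le, hθa, neg_mul]

/-! ## Real-variable bookkeeping (separate lemmas: each elaborates within the default heartbeat budget) -/

/-- Gradient envelope on the doubled ball: `Kp (1+2s)^{q'} + 2κ ≤ (Kp 3^{q'} + 2κ) s^{q'}` for `s ≥ 1`. [folklore] -/
theorem aux_envelope_le {s Kp q' κ : ℝ} (hs1 : 1 ≤ s) (hKp0 : 0 ≤ Kp) (hq'0 : 0 ≤ q') (hκ : 0 ≤ κ) :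
    Kp * (1 + 2 * s) ^ q' + 2 * κ ≤ (Kp * 3 ^ q' + 2 * κ) * s ^ q' := by
  have hs0 : 0 < s := by linarith
  have h1 : (1 + 2 * s) ^ q' ≤ (3 * s) ^ q' := Real.rpow_le_rpow (by positivity) (by linarith) hq'0
  have h2 : (3 * s) ^ q' = 3 ^ q' * s ^ q' := Real.mul_rpow (by norm_num) hs0.le
  have h3 : 1 ≤ s ^ q' := Real.one_le_rpow hs1 hq'0
  have h4 : 2 * κ * 1 ≤ 2 * κ * s ^ q' := mul_le_mul_of_nonneg_left h3 (by positivity)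
  have h5 : Kp * (1 + 2 * s) ^ q' ≤ Kp * (3 ^ q' * s ^ q') := mul_le_mul_of_nonneg_left (h2 ▸ h1) hKp0
  calc Kp * (1 + 2 * s) ^ q' + 2 * κ ≤ Kp * (3 ^ q' * s ^ q') + 2 * κ * s ^ q' := by linarith only [h4, h5]
    _ = (Kp * 3 ^ q' + 2 * κ) * s ^ q' := by ring

/-- Polynomial gradient bound on the ball `B(y, r)`, `r ≤ ‖y‖`: `‖∇V‖ ≤ Kp (1 + 2‖y‖)^{q'}` there
(`K ≤ Kp`, `0 ≤ Kp`, `q ≤ q'`, `0 ≤ q'`). [folklore] -/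
theorem aux_grad_ball {V : EuclideanSpace ℝ (Fin 3) → EuclideanSpace ℝ (Fin 3)} {K q Kp q' : ℝ}
    (hgrad : ∀ y, ‖fderiv ℝ V y‖ ≤ K * (1 + ‖y‖) ^ q) (hKKp : K ≤ Kp) (hKp0 : 0 ≤ Kp) (hqq' : q ≤ q')
    (hq'0 : 0 ≤ q') {y : EuclideanSpace ℝ (Fin 3)} {r : ℝ} (hr : r ≤ ‖y‖) :
    ∀ y' ∈ ball y r, ‖fderiv ℝ V y'‖ ≤ Kp * (1 + 2 * ‖y‖) ^ q' := by
  intro y' hy'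
  rw [mem_ball, dist_eq_norm] at hy'
  have hn : ‖y'‖ ≤ 2 * ‖y‖ := by
    have h' : ‖y'‖ ≤ ‖y‖ + ‖y' - y‖ := by
      calc ‖y'‖ = ‖y + (y' - y)‖ := by rw [add_sub_cancel]
        _ ≤ ‖y‖ + ‖y' - y‖ := norm_add_le _ _
    linarith
  have h1 : ‖fderiv ℝ V y'‖ ≤ Kp * (1 + ‖y'‖) ^ q :=
    (hgrad y').trans (mul_le_mul_of_nonneg_right hKKp (by positivity))
  have h2 : (1 + ‖y'‖) ^ q ≤ (1 + ‖y'‖) ^ q' :=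
    Real.rpow_le_rpow_of_exponent_le (by linarith [norm_nonneg y']) hqq'
  have h3 : (1 + ‖y'‖) ^ q' ≤ (1 + 2 * ‖y‖) ^ q' := Real.rpow_le_rpow (by positivity) (by linarith) hq'0
  exact h1.trans (mul_le_mul_of_nonneg_left (h2.trans h3) hKp0)

/-- The disc budget `D = 32𝓐/(κk² s₀² h)/π` of the short cylinder is `≤ 7 s²` for large `s`
(`𝓐 = c(3s)^{1−2ρ}+1`, `κk = κ/2`, `s₀ = s − r/4`, `h = r/2`, `κ s ≤ 2 M s^{q'} r`, `8192(3c+1)M ≤ 49πκ³ s`). [folklore] -/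
theorem aux_budget_le {s r κ M c q' ρ : ℝ} (hs1 : 1 ≤ s) (hκ : 0 < κ) (hc : 0 ≤ c) (hρ : 0 ≤ ρ)
    (hq'3 : q' ≤ 3) (hr0 : 0 < r) (hrs : r ≤ s / 4) (hκs : κ * s ≤ 2 * M * s ^ q' * r)
    (hsA : 8192 * (3 * c + 1) * M ≤ 49 * π * κ ^ 3 * s) :
    32 * (c * (3 * s) ^ (1 - 2 * ρ) + 1) / ((κ / 2) ^ 2 * (s - r / 4) ^ 2 * (r / 2)) / π ≤ 7 * s ^ 2 := by
  have hs0 : 0 < s := by linarith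
  have hs₀l : 15 / 16 * s ≤ s - r / 4 := by linarith
  have hs₀0 : 0 < s - r / 4 := by linarith
  have hden : 0 < (κ / 2) ^ 2 * (s - r / 4) ^ 2 * (r / 2) := by positivity
  rw [div_le_iff₀ Real.pi_pos, div_le_iff₀ hden]
  -- `𝓐 ≤ (3c+1) s`
  have h𝓐 : c * (3 * s) ^ (1 - 2 * ρ) + 1 ≤ (3 * c + 1) * s := by
    have h1 : (3 * s) ^ (1 - 2 * ρ) ≤ (3 * s) ^ (1 : ℝ) :=
      Real.rpow_le_rpow_of_exponent_le (by linarith) (by linarith)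
    rw [Real.rpow_one] at h1
    have h2 : c * (3 * s) ^ (1 - 2 * ρ) ≤ c * (3 * s) := mul_le_mul_of_nonneg_left h1 hc
    linarith only [h2, hs1]
  -- `8192 (3c+1) M s^{q'} ≤ 49 π κ³ s⁴`
  have hsq0 : 0 < s ^ q' := Real.rpow_pos_of_pos hs0 _
  have hsq' : s ^ q' ≤ s ^ 3 := by
    have h := Real.rpow_le_rpow_of_exponent_le hs1 hq'3
    have h3 : s ^ (3 : ℝ) = s ^ 3 := by exact_mod_cast Real.rpow_natCast s 3
    rwa [h3] at h
  have hpoly : 8192 * (3 * c + 1) * M * s ^ q' ≤ 49 * π * κ ^ 3 * s ^ 4 := by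
    calc 8192 * (3 * c + 1) * M * s ^ q' ≤ (49 * π * κ ^ 3 * s) * s ^ 3 :=
          mul_le_mul hsA hsq' hsq0.le (by positivity)
      _ = 49 * π * κ ^ 3 * s ^ 4 := by ring
  have hs₀2 : 225 / 256 * s ^ 2 ≤ (s - r / 4) ^ 2 := by
    have h := pow_le_pow_left₀ (by positivity) hs₀l 2
    have e : (15 / 16 * s) ^ 2 = 225 / 256 * s ^ 2 := by ring
    rwa [e] at h
  have key : 64 * (3 * c + 1) * M * s ^ q' * s ≤ 7 / 8 * π * κ ^ 3 * s ^ 3 * (s - r / 4) ^ 2 := by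
    have k1 : 64 * (3 * c + 1) * M * s ^ q' * s ≤ 49 / 128 * π * κ ^ 3 * s ^ 5 := by
      have h := mul_le_mul_of_nonneg_right hpoly hs0.le
      have e1 : 8192 * (3 * c + 1) * M * s ^ q' * s = 128 * (64 * (3 * c + 1) * M * s ^ q' * s) := by ring
      have e2 : 49 * π * κ ^ 3 * s ^ 4 * s = 128 * (49 / 128 * π * κ ^ 3 * s ^ 5) := by ring
      rw [e1, e2] at h
      linarith only [h]
    have k2 : 49 / 128 * s ^ 2 ≤ 7 / 8 * (s - r / 4) ^ 2 := by linarith only [hs₀2, sq_nonneg s]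
    have hp : 0 ≤ π * κ ^ 3 * s ^ 3 := by positivity
    calc 64 * (3 * c + 1) * M * s ^ q' * s ≤ 49 / 128 * π * κ ^ 3 * s ^ 5 := k1
      _ = (π * κ ^ 3 * s ^ 3) * (49 / 128 * s ^ 2) := by ring
      _ ≤ (π * κ ^ 3 * s ^ 3) * (7 / 8 * (s - r / 4) ^ 2) := mul_le_mul_of_nonneg_left k2 hp
      _ = 7 / 8 * π * κ ^ 3 * s ^ 3 * (s - r / 4) ^ 2 := by ring
  have hfin : 32 * (c * (3 * s) ^ (1 - 2 * ρ) + 1) * (κ * s) ≤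
      7 * s ^ 2 * π * ((κ / 2) ^ 2 * (s - r / 4) ^ 2 * (r / 2)) * (κ * s) := by
    calc 32 * (c * (3 * s) ^ (1 - 2 * ρ) + 1) * (κ * s) ≤ 32 * ((3 * c + 1) * s) * (κ * s) :=
          mul_le_mul_of_nonneg_right (by linarith only [h𝓐]) (by positivity)
      _ ≤ 32 * ((3 * c + 1) * s) * (2 * M * s ^ q' * r) := mul_le_mul_of_nonneg_left hκs (by positivity)
      _ = (64 * (3 * c + 1) * M * s ^ q' * s) * r := by ring
      _ ≤ (7 / 8 * π * κ ^ 3 * s ^ 3 * (s - r / 4) ^ 2) * r := mul_le_mul_of_nonneg_right key hr0.le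
      _ = 7 * s ^ 2 * π * ((κ / 2) ^ 2 * (s - r / 4) ^ 2 * (r / 2)) * (κ * s) := by ring
  exact le_of_mul_le_mul_right hfin (by positivity)

/-- The short cylinder and its disc fit in `B(0, 3s)`. [folklore] -/
theorem aux_fit {s r D δ : ℝ} (hs : 0 ≤ s) (hr0 : 0 ≤ r) (hrs : r ≤ s / 4) (hD : D ≤ 7 * s ^ 2)
    (hδ : δ ^ 2 = (r / 2) ^ 2 + D) : (s - r / 4 + r / 2) ^ 2 + δ ^ 2 ≤ (3 * s) ^ 2 := by
  have h1 : (s - r / 4 + r / 2) ^ 2 ≤ (17 / 16 * s) ^ 2 := pow_le_pow_left₀ (by linarith) (by linarith) 2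
  have h2 : (r / 2) ^ 2 ≤ (s / 8) ^ 2 := pow_le_pow_left₀ (by linarith) (by linarith) 2
  have e1 : (17 / 16 * s) ^ 2 = 289 / 256 * s ^ 2 := by ring
  have e2 : (s / 8) ^ 2 = 1 / 64 * s ^ 2 := by ring
  have e3 : (3 * s) ^ 2 = 9 * s ^ 2 := by ring
  rw [e1] at h1
  rw [e2] at h2
  rw [hδ, e3]
  linarith only [h1, h2, hD, sq_nonneg s]

/-- The kernel's exponent dominates `B₀ s^{2+ρ−q'}`, `B₀ = 7πκ³/(12288 M C₁)`. [folklore] -/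
theorem aux_exponent_ge {s r κ M C₁ q' ρ : ℝ} (hs1 : 1 ≤ s) (hκ : 0 < κ) (hM : 0 < M) (hC₁ : 0 < C₁)
    (hρ : 0 ≤ ρ) (hr0 : 0 < r) (hrs : r ≤ s / 4) (hκs : κ * s ≤ 2 * M * s ^ q' * r) :
    7 * π * κ ^ 3 / (12288 * M * C₁) * s ^ (2 + ρ - q') ≤
      π * (κ / 2 * (s - r / 4)) ^ 2 * (r / 2) / (16 * ((3 * s) ^ (1 - ρ) * C₁)) := by
  have hs0 : 0 < s := by linarith
  have hMne : M ≠ 0 := hM.ne'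
  have hC₁ne : C₁ ≠ 0 := hC₁.ne'
  have h3s : 0 < (3 * s) ^ (1 - ρ) := Real.rpow_pos_of_pos (by positivity) _
  rw [le_div_iff₀ (by positivity)]
  have h1 : (3 * s) ^ (1 - ρ) ≤ 3 * s ^ (1 - ρ) := by
    rw [Real.mul_rpow (by norm_num) hs0.le]
    have : (3 : ℝ) ^ (1 - ρ) ≤ (3 : ℝ) ^ (1 : ℝ) := Real.rpow_le_rpow_of_exponent_le (by norm_num) (by linarith)
    rw [Real.rpow_one] at this
    exact mul_le_mul_of_nonneg_right this (by positivity)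
  have hs3 : s ^ (3 : ℝ) = s ^ 3 := by exact_mod_cast Real.rpow_natCast s 3
  have h3 : s ^ (2 + ρ - q') * s ^ q' * s ^ (1 - ρ) = s ^ 3 := by
    rw [← Real.rpow_add hs0, ← Real.rpow_add hs0, ← hs3]
    congr 1
    ring
  have hsθ : 0 < s ^ (2 + ρ - q') := Real.rpow_pos_of_pos hs0 _
  have hsq0 : 0 < s ^ q' := Real.rpow_pos_of_pos hs0 _
  -- `κ s^θ s^{1−ρ} ≤ 2 M s² r` from `κ s ≤ 2 M s^{q'} r`
  have h4 : κ * s ^ (2 + ρ - q') * s ^ (1 - ρ) ≤ 2 * M * s ^ 2 * r := by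
    have h4b : κ * s ^ 3 ≤ (2 * M * s ^ 2 * r) * s ^ q' := by
      have h := mul_le_mul_of_nonneg_right hκs (pow_nonneg hs0.le 2)
      have e1 : κ * s * s ^ 2 = κ * s ^ 3 := by ring
      have e2 : 2 * M * s ^ q' * r * s ^ 2 = (2 * M * s ^ 2 * r) * s ^ q' := by ring
      rw [e1, e2] at h
      exact h
    have h4c : (κ * s ^ (2 + ρ - q') * s ^ (1 - ρ)) * s ^ q' ≤ (2 * M * s ^ 2 * r) * s ^ q' := by
      have e : (κ * s ^ (2 + ρ - q') * s ^ (1 - ρ)) * s ^ q' = κ * s ^ 3 := by rw [← h3]; ring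
      rw [e]
      exact h4b
    exact le_of_mul_le_mul_right h4c hsq0
  have hs₀2 : (15 / 16 * s) ^ 2 ≤ (s - r / 4) ^ 2 := pow_le_pow_left₀ (by positivity) (by linarith) 2
  have l1 : 7 * π * κ ^ 3 / (12288 * M * C₁) * s ^ (2 + ρ - q') * (16 * ((3 * s) ^ (1 - ρ) * C₁)) =
      7 * π * κ ^ 3 / (768 * M) * (s ^ (2 + ρ - q') * (3 * s) ^ (1 - ρ)) := by
    field_simp
    ring
  calc 7 * π * κ ^ 3 / (12288 * M * C₁) * s ^ (2 + ρ - q') * (16 * ((3 * s) ^ (1 - ρ) * C₁))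
      = 7 * π * κ ^ 3 / (768 * M) * (s ^ (2 + ρ - q') * (3 * s) ^ (1 - ρ)) := l1
    _ ≤ 7 * π * κ ^ 3 / (768 * M) * (s ^ (2 + ρ - q') * (3 * s ^ (1 - ρ))) :=
        mul_le_mul_of_nonneg_left (mul_le_mul_of_nonneg_left h1 hsθ.le) (by positivity)
    _ = 7 * π * κ ^ 2 / (256 * M) * (κ * s ^ (2 + ρ - q') * s ^ (1 - ρ)) := by ring
    _ ≤ 7 * π * κ ^ 2 / (256 * M) * (2 * M * s ^ 2 * r) := mul_le_mul_of_nonneg_left h4 (by positivity)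
    _ = 7 / 128 * (π * κ ^ 2 * s ^ 2 * r) := by field_simp; ring
    _ ≤ 225 / 2048 * (π * κ ^ 2 * s ^ 2 * r) := mul_le_mul_of_nonneg_right (by norm_num) (by positivity)
    _ = π * κ ^ 2 / 8 * (15 / 16 * s) ^ 2 * r := by ring
    _ ≤ π * κ ^ 2 / 8 * (s - r / 4) ^ 2 * r :=
        mul_le_mul_of_nonneg_right (mul_le_mul_of_nonneg_left hs₀2 (by positivity)) hr0.le
    _ = π * (κ / 2 * (s - r / 4)) ^ 2 * (r / 2) := by ring

/-- The final contradiction: `κ s ≤ 2 M P r`, `r/2 ≤ 3 s E` and `(12M/κ)·(P E) < 1` are incompatible. [folklore] -/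
theorem aux_contra {s r κ M P E : ℝ} (hs0 : 0 < s) (hκ : 0 < κ) (hM : 0 ≤ M) (hP : 0 ≤ P)
    (hκs : κ * s ≤ 2 * M * P * r) (hw3 : r / 2 ≤ 3 * s * E) (hev : 12 * M / κ * (P * E) < 1) : False := by
  have h1 : κ * s ≤ (12 * M * (P * E)) * s := by
    calc κ * s ≤ 2 * M * P * r := hκs
      _ = 4 * M * P * (r / 2) := by ring
      _ ≤ 4 * M * P * (3 * s * E) := mul_le_mul_of_nonneg_left hw3 (by positivity)
      _ = (12 * M * (P * E)) * s := by ring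
  have h2 : κ ≤ 12 * M * (P * E) := le_of_mul_le_mul_right h1 hs0
  have h3 : 1 ≤ 12 * M / κ * (P * E) := by
    rw [div_mul_eq_mul_div, le_div_iff₀ hκ, one_mul]
    exact h2
  linarith only [h3, hev]

end Summit.NavierStokesRegularity.NavierStokesRegularity.Theorems.PowerGaugeEulerLiouville.NeedleGradientGrowth

end
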